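import Summits.Ventures.PercRepro.RLSRuleSixClassify

/-!
# The planes of the core: the complete list of types (night-3, gen 4)

On a core matroid every plane `G` has `≤ 6` points (`card_le_six_of_core`), no `4`-point line, and is one of
* line-free (`U₃,₃`, `U₃,₄`, `U₃,₅`; `LineFree`),
* one `3`-point line plus `≤ 2` points (`ℓ₃ ∪ {a}`, `ℓ₃ ∪ {a, b}`; `OneLine`),
* two `3`-point lines — through a point on `5` points, disjoint or through a point on `6` (`TwoLinesAny`),
* the triangle (`Triangle`) or `K₄` (`KFour`) on `6` points.
**`plane_type_of_core`** — the case split behind `R3PlusPerFlat` for `p ≥ 8` and the one p3's `SevenThreeSmallPlanes`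
(Lemma PL(7,3) on the core) needs.  Imports `RLSRuleSixClassify`.  Axioms: standard.
-/

open scoped Matroid

namespace PercRepro

namespace NightThree

open Finset ThmH PerFlat

variable {α : Type*} [DecidableEq α] {M : Matroid α} [M.Finite]

open scoped Classical in
/-- **The types of the planes of the core.** -/
theorem plane_type_of_core {p : ℕ} (hc : Core M p) {G : Finset α} (hG : G ∈ flatsQ M 3) :
    LineFree M G ∨ (∃ ℓ, OneLine M G ℓ) ∨ (∃ ℓ ℓ', TwoLinesAny M G ℓ ℓ') ∨
      Triangle M G (depTriples M G) ∨ KFour M G (depTriples M G) := by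
  have hGE : G ⊆ gr M := (mem_flatsQ.1 hG).1
  have hsimple := simpleOn_of_core hc hGE
  have hlong := not_hasLongLine_of_core hc hGE
  have h6 := card_le_six_of_core hc hG
  rcases (show G.card ≤ 5 ∨ G.card = 6 by omega) with h5 | h6'
  · have hd := card_depTriples_le_two_of_card_le_five hsimple hlong hGE h5
    rcases (show (depTriples M G).card = 0 ∨ (depTriples M G).card = 1 ∨ (depTriples M G).card = 2 by omega)
      with h0 | h1 | h2
    · left
      exact lineFree_of_depTriples_empty (Finset.card_eq_zero.1 h0)
    · right; left
      obtain ⟨ℓ, hℓ⟩ := Finset.card_eq_one.1 h1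
      exact ⟨ℓ, oneLine_of_depTriples_singleton hsimple hℓ⟩
    · right; right; left
      obtain ⟨ℓ, ℓ', hne, hℓ⟩ := Finset.card_eq_two.1 h2
      exact ⟨ℓ, ℓ', twoLinesAny_of_depTriples_pair hsimple hne hℓ⟩
  · rcases classify_six hc hG h6' with h | h | h
    · right; right; left; exact h
    · right; right; right; left; exact h
    · right; right; right; right; exact h

open scoped Classical in
/-- The size of a plane of the core with a given type: line-free planes have `3 ≤ |G| ≤ 5`, one-line planes
`4 ≤ |G| ≤ 5`, two-line planes `5 ≤ |G| ≤ 6`, the triangle and `K₄` exactly `6` (the sizes from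
`card_le_six_of_core` and `exists_line_avoiding_of_six`: a `6`-point plane has no point on every line). -/
theorem card_of_plane_type_of_core {p : ℕ} (hc : Core M p) {G : Finset α} (hG : G ∈ flatsQ M 3) :
    (LineFree M G → 3 ≤ G.card ∧ G.card ≤ 5) ∧ (∀ ℓ, OneLine M G ℓ → 4 ≤ G.card ∧ G.card ≤ 5) ∧
      (∀ ℓ ℓ', TwoLinesAny M G ℓ ℓ' → 5 ≤ G.card ∧ G.card ≤ 6) := by
  have h6 := card_le_six_of_core hc hG
  have h3 := three_le_card_of_eRk_eq_three (eRk_eq_three_of_mem_flatsQ' hG)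
  have hGE : G ⊆ gr M := (mem_flatsQ.1 hG).1
  -- a `6`-point plane has a line avoiding each point; a point on every line contradicts it
  have hsix : G.card = 6 → ∀ v ∈ G, ∃ ℓ ∈ depTriples M G, v ∉ ℓ := fun h6' v hv =>
    exists_line_avoiding_of_six hc hG h6' hv
  refine ⟨fun hLF => ⟨h3, ?_⟩, fun ℓ hℓ => ⟨?_, ?_⟩, fun ℓ ℓ' h => ⟨?_, h6⟩⟩
  · -- line-free: no dependent triple at all, so no line avoids anything
    by_contra hcon
    obtain ⟨v, hv⟩ : G.Nonempty := Finset.card_pos.1 (by omega)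
    obtain ⟨m, hm, _⟩ := hsix (by omega) v hv
    unfold depTriples at hm
    rw [Finset.mem_filter] at hm
    exact hm.2 (hLF m hm.1)
  · have := Finset.card_le_card hℓ.1
    have hℓ3 := hℓ.2.1
    -- `ℓ ⊊ G`: a plane of rank `3` is not a line
    by_contra hlt
    have heq : ℓ = G := Finset.eq_of_subset_of_card_le hℓ.1 (by omega)
    have := eRk_eq_three_of_mem_flatsQ' hG
    rw [← heq, hℓ.2.2.1] at this
    exact absurd this (by decide)
  · by_contra hcon
    obtain ⟨v, hv⟩ : ∃ v, v ∈ ℓ := Finset.card_pos.1 (by rw [hℓ.2.1]; norm_num)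
    obtain ⟨m, hm, hvm⟩ := hsix (by omega) v (hℓ.1 hv)
    unfold depTriples at hm
    rw [Finset.mem_filter, Finset.mem_powersetCard] at hm
    have hmℓ : m ≠ ℓ := fun h => hvm (h ▸ hv)
    exact hm.2 (hℓ.2.2.2 m (Finset.mem_powersetCard.2 hm.1) hmℓ)
  · -- two distinct `3`-lines meeting in `≤ 1` point span `≥ 5` points
    have hGE' := hGE
    have hi := card_inter_le_one_of_lines (simpleOn_of_core hc hGE) (not_hasLongLine_of_core hc hGE) hGE h.1 h.2.1
      h.2.2.1 h.2.2.2.1 h.2.2.2.2.1 h.2.2.2.2.2.1 h.2.2.2.2.2.2.1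
    have hu := Finset.card_union_add_card_inter ℓ ℓ'
    have := Finset.card_le_card (Finset.union_subset h.1 h.2.1)
    have := h.2.2.1; have := h.2.2.2.1
    omega

/-- **On the core two `3`-point lines of a `6`-point plane always meet** (the engine's census 4828: the shape «two
disjoint lines» never occurs on the core): for `e` on one line the `e`-free partition of `G ∖ {e}` into two rank-`≤ 2`
parts is impossible — a part with both other points of `e`'s line closes onto `e`, and a part with one of them and
two points of the other line has rank `3`. -/
theorem card_inter_eq_one_of_twoLinesAny_six_core {p : ℕ} (hc : Core M p) {G ℓ ℓ' : Finset α}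
    (hG : G ∈ flatsQ M 3) (h : TwoLinesAny M G ℓ ℓ') (hGc : G.card = 6) : (ℓ ∩ ℓ').card = 1 := by
  classical
  have hGE : G ⊆ gr M := (mem_flatsQ.1 hG).1
  have hi := card_inter_le_one_of_lines (simpleOn_of_core hc hGE) (not_hasLongLine_of_core hc hGE) hGE h.1 h.2.1
    h.2.2.1 h.2.2.2.1 h.2.2.2.2.1 h.2.2.2.2.2.1 h.2.2.2.2.2.2.1
  by_contra hne
  have hdisj : ℓ ∩ ℓ' = ∅ := Finset.card_eq_zero.1 (by omega)
  have hℓc := h.2.2.1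
  have hℓ'c := h.2.2.2.1
  -- `G = ℓ ⊔ ℓ'`
  have hunion : ℓ ∪ ℓ' = G := by
    apply Finset.eq_of_subset_of_card_le (Finset.union_subset h.1 h.2.1)
    have := Finset.card_union_add_card_inter ℓ ℓ'
    rw [hdisj, Finset.card_empty] at this
    omega
  obtain ⟨e, he⟩ : ℓ.Nonempty := Finset.card_pos.1 (by omega)
  have heG : e ∈ G := h.1 he
  obtain ⟨A₁, A₂, h1, h2, hd, hu, hr1, hr2, he1, he2⟩ := exists_partition_of_core hc hG heG
  have hEE : (G : Set α) ⊆ M.E := by rw [← coe_gr M]; exact Finset.coe_subset.2 hGE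
  -- (i) a part containing `ℓ ∖ {e}` closes onto `e`
  have hclose : ∀ A : Finset α, A ⊆ G.erase e → ℓ.erase e ⊆ A → e ∈ M.closure (A : Set α) := by
    intro A hA hℓA
    obtain ⟨u, v, huv, huv'⟩ : ∃ u v, u ≠ v ∧ ℓ.erase e = {u, v} :=
      Finset.card_eq_two.1 (by rw [Finset.card_erase_of_mem he, hℓc])
    have huℓ : u ∈ ℓ := (Finset.mem_erase.1 (by rw [huv']; exact Finset.mem_insert_self _ _)).2
    have hvℓ : v ∈ ℓ := (Finset.mem_erase.1 (by rw [huv']; exact Finset.mem_insert_of_mem (Finset.mem_singleton_self _))).2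
    have hpair : M.eRk (({u, v} : Finset α) : Set α) = 2 := by
      rw [Finset.coe_pair]
      exact hc.1 u (hEE (Finset.mem_coe.2 (h.1 huℓ))) v (hEE (Finset.mem_coe.2 (h.1 hvℓ))) huv
    have hcl : M.closure (({u, v} : Finset α) : Set α) = M.closure (ℓ : Set α) := by
      apply closure_eq_of_subset_flat (M.isFlat_closure _)
      · exact (Finset.coe_subset.2 (by rw [← huv']; exact Finset.erase_subset _ _)).trans
          (M.subset_closure _ ((Finset.coe_subset.2 h.1).trans hEE))
      · exact Finset.finite_toSet _
      · rw [M.eRk_closure_eq, hpair, h.2.2.2.2.1]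
    have : e ∈ M.closure (({u, v} : Finset α) : Set α) := by
      rw [hcl]; exact M.subset_closure _ ((Finset.coe_subset.2 h.1).trans hEE) (Finset.mem_coe.2 he)
    exact M.closure_mono (by rw [← huv']; exact Finset.coe_subset.2 hℓA) this
  -- (ii) a part containing a point of `ℓ ∖ {e}` and two points of `ℓ'` has rank `3`
  have hrank3 : ∀ A : Finset α, A ⊆ G.erase e → M.eRk (A : Set α) ≤ 2 → ∀ x ∈ ℓ.erase e, x ∈ A →
      (ℓ'.filter (fun y => y ∈ A)).card ≤ 1 := by
    intro A hA hrA x hx hxA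
    by_contra hcon
    push Not at hcon
    obtain ⟨T, hTsub, hTc⟩ := Finset.exists_subset_card_eq (show 2 ≤ (ℓ'.filter (fun y => y ∈ A)).card by omega)
    obtain ⟨y₁, y₂, hy, hT⟩ := Finset.card_eq_two.1 hTc
    have hy₁ : y₁ ∈ ℓ' ∧ y₁ ∈ A := Finset.mem_filter.1 (hTsub (by rw [hT]; exact Finset.mem_insert_self _ _))
    have hy₂ : y₂ ∈ ℓ' ∧ y₂ ∈ A :=
      Finset.mem_filter.1 (hTsub (by rw [hT]; exact Finset.mem_insert_of_mem (Finset.mem_singleton_self _)))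
    have hxℓ : x ∈ ℓ := (Finset.mem_erase.1 hx).2
    have hxℓ' : x ∉ ℓ' := fun hx' => by
      have : x ∈ ℓ ∩ ℓ' := Finset.mem_inter.2 ⟨hxℓ, hx'⟩
      rw [hdisj] at this; exact Finset.notMem_empty _ this
    have hy₁ℓ : y₁ ∉ ℓ := fun hy' => by
      have : y₁ ∈ ℓ ∩ ℓ' := Finset.mem_inter.2 ⟨hy', hy₁.1⟩
      rw [hdisj] at this; exact Finset.notMem_empty _ this
    set S : Finset α := {x, y₁, y₂} with hS
    have hSG : S ⊆ G := by
      intro z hz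
      simp only [hS, Finset.mem_insert, Finset.mem_singleton] at hz
      rcases hz with rfl | rfl | rfl
      · exact h.1 hxℓ
      · exact h.2.1 hy₁.1
      · exact h.2.1 hy₂.1
    have hSc : S.card = 3 := by
      rw [hS, Finset.card_insert_of_notMem, Finset.card_pair hy]
      simp only [Finset.mem_insert, Finset.mem_singleton, not_or]
      exact ⟨fun hh => hxℓ' (hh ▸ hy₁.1), fun hh => hxℓ' (hh ▸ hy₂.1)⟩
    have hSℓ : S ≠ ℓ := fun hh => hy₁ℓ (hh ▸ (by simp [hS]))
    have hSℓ' : S ≠ ℓ' := fun hh => hxℓ' (hh ▸ (by simp [hS]))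
    have hind := h.2.2.2.2.2.2.2.2 S (Finset.mem_powersetCard.2 ⟨hSG, hSc⟩) hSℓ hSℓ'
    have hr3 : M.eRk (S : Set α) = 3 := eRk_eq_three_of_indep_card hind hSc
    have hSA : S ⊆ A := by
      intro z hz
      simp only [hS, Finset.mem_insert, Finset.mem_singleton] at hz
      rcases hz with rfl | rfl | rfl
      · exact hxA
      · exact hy₁.2
      · exact hy₂.2
    have := M.eRk_mono (Finset.coe_subset.2 hSA)
    rw [hr3] at this
    exact absurd (this.trans hrA) (by decide)
  -- the two points of `ℓ ∖ {e}` cannot share a part (i), so they split; then `ℓ'` (3 points, all in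
  -- `A₁ ∪ A₂`) puts two points into one part, contradicting (ii)
  obtain ⟨u, v, huv, huv'⟩ : ∃ u v, u ≠ v ∧ ℓ.erase e = {u, v} :=
    Finset.card_eq_two.1 (by rw [Finset.card_erase_of_mem he, hℓc])
  have huℓe : u ∈ ℓ.erase e := by rw [huv']; exact Finset.mem_insert_self _ _
  have hvℓe : v ∈ ℓ.erase e := by rw [huv']; exact Finset.mem_insert_of_mem (Finset.mem_singleton_self _)
  have hℓeG : ℓ.erase e ⊆ G.erase e := fun z hz =>
    Finset.mem_erase.2 ⟨(Finset.mem_erase.1 hz).1, h.1 (Finset.mem_erase.1 hz).2⟩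
  have hmem : ∀ z ∈ G.erase e, z ∈ A₁ ∨ z ∈ A₂ := fun z hz => by
    rw [← hu] at hz; exact Finset.mem_union.1 hz
  have hℓ'G : ℓ' ⊆ G.erase e := fun y hy => by
    refine Finset.mem_erase.2 ⟨fun hye => ?_, h.2.1 hy⟩
    have : y ∈ ℓ ∩ ℓ' := Finset.mem_inter.2 ⟨hye ▸ he, hy⟩
    rw [hdisj] at this; exact Finset.notMem_empty _ this
  have hsplit : ∀ A : Finset α, A ⊆ G.erase e → M.eRk (A : Set α) ≤ 2 → e ∉ M.closure (A : Set α) →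
      ∀ x ∈ ℓ.erase e, x ∈ A → (ℓ'.filter (fun y => y ∈ A)).card ≤ 1 := fun A hA hrA _ x hx hxA =>
    hrank3 A hA hrA x hx hxA
  -- the count of `ℓ'` over the two parts
  have hcount : 3 ≤ (ℓ'.filter (fun y => y ∈ A₁)).card + (ℓ'.filter (fun y => y ∈ A₂)).card := by
    have h12 := Finset.card_filter_add_card_filter_not (s := ℓ') (fun y => y ∈ A₁)
    have hsub : ℓ'.filter (fun y => ¬ y ∈ A₁) ⊆ ℓ'.filter (fun y => y ∈ A₂) := by
      intro y hy
      rw [Finset.mem_filter] at hy ⊢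
      exact ⟨hy.1, (hmem y (hℓ'G hy.1)).resolve_left hy.2⟩
    have := Finset.card_le_card hsub
    omega
  rcases hmem u (hℓeG huℓe) with hu1 | hu2 <;> rcases hmem v (hℓeG hvℓe) with hv1 | hv2
  · -- both in `A₁`
    apply he1; apply hclose A₁ h1
    intro z hz; rw [huv'] at hz; rw [Finset.mem_insert, Finset.mem_singleton] at hz
    rcases hz with rfl | rfl <;> assumption
  · have ha := hsplit A₁ h1 hr1 he1 u huℓe hu1
    have hb := hsplit A₂ h2 hr2 he2 v hvℓe hv2
    omega
  · have ha := hsplit A₂ h2 hr2 he2 u huℓe hu2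
    have hb := hsplit A₁ h1 hr1 he1 v hvℓe hv1
    omega
  · apply he2; apply hclose A₂ h2
    intro z hz; rw [huv'] at hz; rw [Finset.mem_insert, Finset.mem_singleton] at hz
    rcases hz with rfl | rfl <;> assumption

end NightThree

end PercRepro
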